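import Summits.Ventures.PackingBounds.Energy.TenPointCkSixGramDataE1
import Summits.Ventures.PackingBounds.Energy.TenPointCkSixGramDataE2
import Summits.Ventures.PackingBounds.Energy.TenPointCkSixGramDataE3
import HarnessLib

/-!
# Integer Gram data `S·Y = L Lᵀ + E` (the rows of E: the table (collector of 3 part modules)) of the 153 × 153 SOS block of the exact sharp three-point certificate
# `e3pt-sharp-n4N10ck6d8-rat.json` (two orthogonal regular pentagons (4,10); ten points on S³, single SOS term, d = 8)

Framing: lottery ticket; floor = certified bounds/negative ranges. Venture `PackingBounds`, cell `pub-packcert`, energy family E3PT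
(pub-packcert-energy gen 15; KERNEL-D6 data route). `yW6` = S·Y (S = `scaleW6` = lcm of denominators · 2^40), `lW6` = rounded scaled Cholesky
factor, `eW6` = S·Y − lW6·lW6ᵀ (exact; symmetric, diagonally dominant). Checked by `decide +kernel` with `GramData.checkRows` / `checkDD`
in `TenPointCkSixGramFacts*`; generator `pub-packcert-energy/code/e3pt/g15/e3pt_lean_n4y.py`. (Rows split in independent modules for the gate's request-size limit; one collector per table.)
-/

namespace Summit.Ventures.PackingBounds.Energy.PentagonsSixD8

/-- data rows. -/
def eW6 : List (List ℤ) := [eW60, eW61, eW62, eW63, eW64, eW65, eW66, eW67, eW68, eW69, eW610, eW611, eW612, eW613, eW614, eW615, eW616, eW617, eW618, eW619, eW620, eW621, eW622, eW623, eW624, eW625, eW626, eW627, eW628, eW629, eW630, eW631, eW632, eW633, eW634, eW635, eW636, eW637, eW638, eW639, eW640, eW641, eW642, eW643, eW644, eW645, eW646, eW647, eW648, eW649, eW650, eW651, eW652, eW653, eW654, eW655, eW656, eW657, eW658, eW659, eW660, eW661, eW662, eW663, eW664, eW665, eW666, eW667, eW668, eW669, eW670, eW671, eW672, eW673, eW674,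 eW675, eW676, eW677, eW678, eW679, eW680, eW681, eW682, eW683, eW684, eW685, eW686, eW687, eW688, eW689, eW690, eW691, eW692, eW693, eW694, eW695, eW696, eW697, eW698, eW699, eW6100, eW6101, eW6102, eW6103, eW6104, eW6105, eW6106, eW6107, eW6108, eW6109, eW6110, eW6111, eW6112, eW6113, eW6114, eW6115, eW6116, eW6117, eW6118, eW6119, eW6120, eW6121, eW6122, eW6123, eW6124, eW6125, eW6126, eW6127, eW6128, eW6129, eW6130, eW6131, eW6132, eW6133, eW6134, eW6135, eW6136, eW6137, eW6138, eW6139, eW6140, eW6141, eW6142, eW6143, eW6144, eW6145, eW6146, eW6147, eW6148, eW6149, eW6150, eW6151, eW6152]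

end Summit.Ventures.PackingBounds.Energy.PentagonsSixD8
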